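import Mathlib
import HarnessLib
import Summits.RiemannHypothesis.RiemannHypothesis.Theorems.IntegerScrewWalkGenerator

/-!
# Route `IntegerScrew` — reversibility of the truncated multiplicative walk and its Dirichlet form

The τ-time generator `walkGen M` of `IntegerScrewWalkGenerator` (births `k → kn` at rate `Λ(n)/(nL)`, deaths
`kn → k` at rate `Λ(n)/L`, `L = log M`) is REVERSIBLE for the harmonic weight `π(k) ∝ 1/k`:
`walkRate(k,j)/k = walkRate(j,k)/j` (`walkRate_detailed_balance`).  Consequences recorded here (all RH-free):

* `walkGen_row_sum`, `sum_walkGen_div_eq_zero` — rows sum to `0`, and `π` is invariant (`Σ_k walkGen(k,j)/k = 0`);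
* `dirichlet_add_const` — the Dirichlet energy `E(g) = −Σ_k (g(k)/k)·(walkGen·g)(k)` ignores additive constants;
* **`dirichlet_eq_half_sum_sq`** — `E(g) = ½ Σ_k Σ_j (walkGen(k,j)/k)·(g(j) − g(k))²`;
* **`dirichlet_nonneg`** — `E(g) ≥ 0`: `−walkGen M` is a non-negative self-adjoint operator on `ℓ²(π)`, so its
  spectrum is `0 = λ₀ ≤ λ₁ ≤ …` and the gap `λ₁` is the minimum of `E(g)/‖g‖²_π` over `g ⊥_π 1` (used with the
  explicit test function of `IntegerScrewParityGap.walk_gap_lt`).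

References: PIVOT-LAW §13.10 (rh-explicit A6-PIVOT); M. Suzuki, J. Lond. Math. Soc. (2) 108 (2023) 1448–1487
[Suzuki2023] (the walk is the probabilistic model of the screw-criterion window problem, PROP. N4).
-/

noncomputable section

set_option linter.dupNamespace false -- D-0017: `Summit.<S>.<S>.…` is the designed namespace

namespace Summit.RiemannHypothesis.RiemannHypothesis.Theorems.IntegerScrew

open Finset ArithmeticFunction

/-! ### Reversibility and π-invariance -/
/-- **Detailed balance** for `π(k) ∝ 1/k`: `walkRate(k,j)/k = walkRate(j,k)/j` (`k, j ≥ 1`). -/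
theorem walkRate_detailed_balance (L : ℝ) {k j : ℕ} (hk : 1 ≤ k) (hj : 1 ≤ j) :
    walkRate L k j / k = walkRate L j k / j := by
  unfold walkRate
  by_cases hkj : k = j
  · subst hkj; simp
  · have hjk : ¬ j = k := fun h => hkj h.symm
    rw [if_neg hkj, if_neg hjk]
    by_cases h1 : k ∣ j
    · have h2 : ¬ j ∣ k := fun h => hkj (Nat.dvd_antisymm h1 h)
      rw [if_pos h1, if_neg h2, if_pos h1]
      obtain ⟨n, rfl⟩ := h1
      have hn : 0 < n := Nat.pos_of_ne_zero (by rintro rfl; simp at hj)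
      rw [Nat.mul_div_cancel_left n hk]
      have hk0 : (k : ℝ) ≠ 0 := by exact_mod_cast (show k ≠ 0 by omega)
      have hn0 : (n : ℝ) ≠ 0 := by exact_mod_cast hn.ne'
      push_cast
      field_simp
    · by_cases h2 : j ∣ k
      · rw [if_neg h1, if_pos h2, if_pos h2]
        obtain ⟨n, rfl⟩ := h2
        have hn : 0 < n := Nat.pos_of_ne_zero (by rintro rfl; simp at hk)
        rw [Nat.mul_div_cancel_left n hj]
        have hj0 : (j : ℝ) ≠ 0 := by exact_mod_cast (show j ≠ 0 by omega)
        have hn0 : (n : ℝ) ≠ 0 := by exact_mod_cast hn.ne'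
        push_cast
        field_simp
      · rw [if_neg h1, if_neg h2, if_neg h2, if_neg h1, zero_div, zero_div]

/-- Detailed balance for the generator: `walkGen(k,j)/k = walkGen(j,k)/j`. -/
theorem walkGen_detailed_balance (M : ℕ) (k j : St M) :
    walkGen M k j / (k : ℕ) = walkGen M j k / (j : ℕ) := by
  by_cases hkj : k = j
  · subst hkj; rfl
  · have hjk : ¬ j = k := fun h => hkj h.symm
    simp only [walkGen, if_neg hkj, if_neg hjk]
    exact walkRate_detailed_balance _ (Finset.mem_Icc.1 k.2).1 (Finset.mem_Icc.1 j.2).1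

/-- The rows of the generator sum to zero. -/
theorem walkGen_row_sum (M : ℕ) (k : St M) : ∑ j : St M, walkGen M k j = 0 := by
  have h := walkGen_sum_eq M (fun _ => (1 : ℝ)) k
  simp only [mul_one, sub_self, mul_zero, Finset.sum_const_zero] at h
  exact h

/-- **π-invariance**: `Σ_k walkGen(k,j)/k = 0` for every `j`. -/
theorem sum_walkGen_div_eq_zero (M : ℕ) (j : St M) : ∑ k : St M, walkGen M k j / (k : ℕ) = 0 := by
  rw [Finset.sum_congr rfl fun k _ => walkGen_detailed_balance M k j, ← Finset.sum_div, walkGen_row_sum,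
    zero_div]

/-- The Dirichlet energy `E(g) = −Σ_k (g(k)/k)·(walkGen·g)(k)` is unchanged by adding a constant. -/
theorem dirichlet_add_const (M : ℕ) (g : St M → ℝ) (c : ℝ) :
    ∑ k : St M, (g k + c) / (k : ℕ) * ∑ j : St M, walkGen M k j * (g j + c) =
      ∑ k : St M, g k / (k : ℕ) * ∑ j : St M, walkGen M k j * g j := by
  have hrow : ∀ k : St M, ∑ j : St M, walkGen M k j * (g j + c) = ∑ j : St M, walkGen M k j * g j := by
    intro k
    simp only [mul_add, Finset.sum_add_distrib, ← Finset.sum_mul, walkGen_row_sum, zero_mul, add_zero]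
  simp only [hrow, add_div, add_mul, Finset.sum_add_distrib]
  have hcol : ∑ k : St M, c / (k : ℕ) * ∑ j : St M, walkGen M k j * g j = 0 := by
    have e : ∀ k : St M, c / (k : ℕ) * ∑ j : St M, walkGen M k j * g j =
        ∑ j : St M, c * (walkGen M k j / (k : ℕ) * g j) := fun k => by
      rw [Finset.mul_sum]; refine Finset.sum_congr rfl fun j _ => by ring
    rw [Finset.sum_congr rfl fun k _ => e k, Finset.sum_comm]
    refine Finset.sum_eq_zero fun j _ => ?_
    rw [← Finset.mul_sum, ← Finset.sum_mul, sum_walkGen_div_eq_zero, zero_mul, mul_zero]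
  rw [hcol, add_zero]

/-! ### The Dirichlet form -/

/-- `(walkGen·g)(k) = Σ_j walkGen(k,j)·(g(j) − g(k))` (rows sum to zero). -/
theorem walkGen_mulVec_eq_sum_sub (M : ℕ) (g : St M → ℝ) (k : St M) :
    ∑ j : St M, walkGen M k j * g j = ∑ j : St M, walkGen M k j * (g j - g k) := by
  simp only [mul_sub, Finset.sum_sub_distrib, ← Finset.sum_mul, walkGen_row_sum, zero_mul, sub_zero]

/-- **Dirichlet form identity** (reversibility):
`−Σ_k (g(k)/k)(walkGen·g)(k) = ½ Σ_k Σ_j (walkGen(k,j)/k)(g(j) − g(k))²`. -/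
theorem dirichlet_eq_half_sum_sq (M : ℕ) (g : St M → ℝ) :
    -(∑ k : St M, g k / (k : ℕ) * ∑ j : St M, walkGen M k j * g j) =
      (1 / 2) * ∑ k : St M, ∑ j : St M, walkGen M k j / (k : ℕ) * (g j - g k) ^ 2 := by
  -- `A = Σ_k Σ_j (G_{kj}/k) g_k (g_j − g_k)` is `−E(g)`; by detailed balance and `k ↔ j`,
  -- `Σ_k Σ_j (G_{kj}/k) g_j (g_j − g_k) = −A`, and the half-sum of squares is `½(−A − A) = −A`.
  set A : ℝ := ∑ k : St M, ∑ j : St M, walkGen M k j / (k : ℕ) * g k * (g j - g k) with hA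
  have hE : ∑ k : St M, g k / (k : ℕ) * ∑ j : St M, walkGen M k j * g j = A := by
    rw [hA]
    refine Finset.sum_congr rfl fun k _ => ?_
    rw [walkGen_mulVec_eq_sum_sub, Finset.mul_sum]
    refine Finset.sum_congr rfl fun j _ => by ring
  have hB : ∑ k : St M, ∑ j : St M, walkGen M k j / (k : ℕ) * g j * (g j - g k) = -A := by
    rw [hA]
    rw [Finset.sum_congr rfl fun k _ => Finset.sum_congr rfl fun j _ => by rw [walkGen_detailed_balance M k j],
      Finset.sum_comm]
    rw [← Finset.sum_neg_distrib]
    refine Finset.sum_congr rfl fun k _ => ?_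
    rw [← Finset.sum_neg_distrib]
    refine Finset.sum_congr rfl fun j _ => by ring
  have hS : ∑ k : St M, ∑ j : St M, walkGen M k j / (k : ℕ) * (g j - g k) ^ 2 =
      ∑ k : St M, ∑ j : St M, walkGen M k j / (k : ℕ) * g j * (g j - g k) -
        ∑ k : St M, ∑ j : St M, walkGen M k j / (k : ℕ) * g k * (g j - g k) := by
    rw [← Finset.sum_sub_distrib]
    refine Finset.sum_congr rfl fun k _ => ?_
    rw [← Finset.sum_sub_distrib]
    refine Finset.sum_congr rfl fun j _ => by ring
  rw [hE, hS, hB, ← hA]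
  ring

/-- **`−walkGen M` is non-negative on `ℓ²(π)`**: `0 ≤ −Σ_k (g(k)/k)(walkGen·g)(k)` for every `g`. -/
theorem dirichlet_nonneg (M : ℕ) (g : St M → ℝ) :
    0 ≤ -(∑ k : St M, g k / (k : ℕ) * ∑ j : St M, walkGen M k j * g j) := by
  rw [dirichlet_eq_half_sum_sq]
  refine mul_nonneg (by norm_num) (Finset.sum_nonneg fun k _ => Finset.sum_nonneg fun j _ => ?_)
  by_cases hkj : k = j
  · subst hkj; simp
  · exact mul_nonneg (div_nonneg (walkGen_offdiag_nonneg M k j hkj) (Nat.cast_nonneg _)) (sq_nonneg _)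

/-- The quadratic form of `walkGen M` in `ℓ²(π)` is `≤ 0`. -/
theorem walkGen_form_nonpos (M : ℕ) (g : St M → ℝ) :
    ∑ k : St M, g k / (k : ℕ) * ∑ j : St M, walkGen M k j * g j ≤ 0 := by
  have h := dirichlet_nonneg M g
  linarith

end Summit.RiemannHypothesis.RiemannHypothesis.Theorems.IntegerScrew

end
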